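import Literature.NumberTheory.DiophantineGeometry.CatalanZCbrt
import Literature.NumberTheory.DiophantineGeometry.CatalanKoChao
import HarnessLib

/-!
# Euler (1738): the only non-zero solutions of `x ² - y ³ = 1` are `(±3, 2)`

This is the case "`p = 2`, `q = 3`" of Catalan's equation `x ^ p - y ^ q = 1` [Schoof2009,
Chapter 4, "The Nontrivial Solution"], the third of the four cases into which the proof of
Catalan's conjecture (`Literature.NumberTheory.DiophantineGeometry.mihailescu`, abc.S19) splits.
We formalise W. McCallum's proof as printed in R. Schoof, *Catalan's Conjecture*, Universitext
(2008), Propositions 4.1 and 4.2 (pp. 15–18), on top of the concrete ring `ZCbrt = ℤ[∛2]` and its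
unit theorem (`CatalanZCbrt`, [Schoof2009, Exercise 4.4]):

* `ZCbrt.eta_pow_c_eq_zero` — **[Schoof2009, Proposition 4.1]** (Skolem's `3`-adic method): the
  `∛4`-coefficient of `ηⁿ` (`η = ∛2 - 1`, `n : ℕ`) vanishes only for `n = 0, 1`; negative
  exponents are covered by `ZCbrt.etaInv_pow_pos` (all coefficients of `(1 + ∛2 + ∛4)ᵐ` are
  positive). With `π = 1 + θ` (`π³ = 3 η⁻¹`, so `3^[k/3]` divides the coefficients `c_k` of
  `πᵏ`) and `-η = 2 - π`, the `θ²`-coefficient of `(-η)ⁿ` is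
  `S = Σₖ (-1)ᵏ C(n,k) 2^(n-k) c_k`; the terms `k = 2, 3, 4` add up to `2^(n-4) C(n,2) M` with
  `2M ≡ n² + 1 ≢ 0 (mod 3)`, while every term with `k ≥ 5` has `ord₃` exceeding `ord₃ C(n,2)`
  (from `C(n,k) C(k,2) = C(n,2) C(n-2,k-2)` and Exercise 4.1, `ord₃ (k(k-1)) < [k/3]`), so
  `S ≠ 0` for `n ≥ 6`; `2 ≤ n ≤ 5` are checked by computation;
* `ZCbrt.thue_cubic` — the Thue equation `v³ - 2u³ = 1` has only the solutions `(u, v) = (0, 1)`,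
  `(-1, -1)` (`v - uθ` is a unit of norm `1`, hence `± η^{±n}`);
* `Catalan.euler` — **[Schoof2009, Proposition 4.2]**: `x ² - y ³ = 1`, `x y ≠ 0` ⟹
  `(x, y) = (±3, 2)` (even `x`: coprime cubes differing by `2`; odd `x`, normalised
  `x ≡ 1 (mod 4)`: `(x-1)/4 = u³`, `(x+1)/2 = v³`, `v³ - 2u³ = 1`).

Everything here is proved; the only definition is the element `π = 1 + θ` (`ZCbrt.piE`).
-/

namespace Literature.NumberTheory.DiophantineGeometry

namespace ZCbrt

open Finset

/-! ## [Schoof2009, Proposition 4.1]: the `∛4`-coefficient of `ηⁿ` vanishes only for `n = 0, 1` -/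

/-- `π = 1 + θ`, a generator of the prime of `ℤ[∛2]` above `3` [Schoof2009, proof of
Proposition 4.1]. [cite: Schoof2009, Proposition 4.1] -/
def piE : ZCbrt := ⟨1, 1, 0⟩

/-- `π³ = 3 (1 + θ + θ²) = 3 η⁻¹` [Schoof2009, proof of Proposition 4.1].
[cite: Schoof2009, Proposition 4.1] -/
theorem piE_pow_three : piE ^ 3 = 3 * etaInv := by decide

/-- `2 - π = 1 - θ = -η` [Schoof2009, proof of Proposition 4.1].
[cite: Schoof2009, Proposition 4.1] -/
theorem two_sub_piE : 2 - piE = -eta := by decide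

/-- The `θ²`-component commutes with finite sums. [folklore] -/
theorem c_sum {ι : Type*} (s : Finset ι) (f : ι → ZCbrt) :
    (∑ i ∈ s, f i).c = ∑ i ∈ s, (f i).c := by
  classical
  induction s using Finset.induction_on with
  | empty => simp
  | insert a s ha ih => rw [Finset.sum_insert ha, Finset.sum_insert ha, add_c', ih]

/-- All components of `πᵏ`, `k ≥ 2`, are positive. [folklore] -/
theorem piE_pow_pos (k : ℕ) (hk : 2 ≤ k) :
    0 < (piE ^ k).a ∧ 0 < (piE ^ k).b ∧ 0 < (piE ^ k).c := by
  induction k with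
  | zero => omega
  | succ k ih =>
    rcases Nat.lt_or_ge k 2 with hk2 | hk2
    · interval_cases k
      · omega
      · decide
    · obtain ⟨ha, hb, hc⟩ := ih hk2
      rw [pow_succ]
      simp only [mul_a', mul_b', mul_c', show piE.a = 1 from rfl, show piE.b = 1 from rfl,
        show piE.c = 0 from rfl]
      refine ⟨by nlinarith, by nlinarith, by nlinarith⟩

/-- All components of `(η⁻¹)ⁿ = (1 + θ + θ²)ⁿ`, `n ≥ 1`, are positive [Schoof2009, proof of
Proposition 4.1: "the coefficients of `(1 + ∛2 + ∛4)^m` … are all positive"].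
[cite: Schoof2009, Proposition 4.1] -/
theorem etaInv_pow_pos (n : ℕ) (hn : 1 ≤ n) :
    0 < (etaInv ^ n).a ∧ 0 < (etaInv ^ n).b ∧ 0 < (etaInv ^ n).c := by
  induction n with
  | zero => omega
  | succ n ih =>
    rcases Nat.eq_zero_or_pos n with rfl | hn1
    · decide
    · obtain ⟨ha, hb, hc⟩ := ih hn1
      rw [pow_succ]
      simp only [mul_a', mul_b', mul_c', show etaInv.a = 1 from rfl, show etaInv.b = 1 from rfl,
        show etaInv.c = 1 from rfl]
      refine ⟨by nlinarith, by nlinarith, by nlinarith⟩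

/-- `3^m` divides every component of `π^(3m + r)` (as `π³ = 3 η⁻¹`) — the divisibility
`3^[k/3] ∣ a_k, b_k, c_k` of [Schoof2009, proof of Proposition 4.1].
[cite: Schoof2009, Proposition 4.1] -/
theorem three_pow_dvd_piE_pow_c (m r : ℕ) : (3 : ℤ) ^ m ∣ (piE ^ (3 * m + r)).c := by
  rw [pow_add, pow_mul, piE_pow_three, mul_pow]
  have h3 : ((3 : ZCbrt)) ^ m = ((3 ^ m : ℤ) : ZCbrt) := by push_cast; rfl
  rw [h3, mul_assoc, mul_c', intCast_a, intCast_b, intCast_c]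
  simp

/-- The `θ²`-component `c_k` of `πᵏ` is divisible by `3^[k/3]`.
[cite: Schoof2009, Proposition 4.1] -/
theorem three_pow_dvd_piE_pow_c' (k : ℕ) : (3 : ℤ) ^ (k / 3) ∣ (piE ^ k).c := by
  have h := three_pow_dvd_piE_pow_c (k / 3) (k % 3)
  rwa [Nat.div_add_mod k 3] at h

/-- The expansion `(-η)ⁿ = (2 - π)ⁿ = Σₖ C(n,k) 2^(n-k) (-π)ᵏ` on the `θ²`-component
[Schoof2009, proof of Proposition 4.1 (with `-η/2 = 1 - π/2` multiplied through by `2ⁿ`)].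
[cite: Schoof2009, Proposition 4.1] -/
theorem neg_eta_pow_c (n : ℕ) :
    ((-eta) ^ n).c =
      ∑ k ∈ Finset.range (n + 1), (-1) ^ k * (piE ^ k).c * 2 ^ (n - k) * (n.choose k : ℤ) := by
  rw [← two_sub_piE, sub_eq_neg_add, add_pow, c_sum]
  refine Finset.sum_congr rfl fun k _ => ?_
  have h1 : (-piE) ^ k * (2 : ZCbrt) ^ (n - k) * (n.choose k : ZCbrt) =
      (((-1) ^ k : ℤ) : ZCbrt) * piE ^ k * (((2 ^ (n - k) * n.choose k : ℤ)) : ZCbrt) := by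
    push_cast
    rw [neg_pow]
    ring
  rw [h1, mul_c', mul_a', mul_b']
  simp only [mul_c', intCast_a, intCast_b, intCast_c]
  ring

/-- `c(ηⁿ) = (-1)ⁿ c((-η)ⁿ)`. [folklore] -/
theorem eta_pow_c (n : ℕ) : (eta ^ n).c = (-1) ^ n * ((-eta) ^ n).c := by
  have h : (-eta) ^ n = (((-1) ^ n : ℤ) : ZCbrt) * eta ^ n := by
    rw [neg_pow]; push_cast; ring
  rw [h, mul_c', intCast_a, intCast_b, intCast_c]
  simp only [zero_mul, add_zero]
  rw [← mul_assoc, ← mul_pow]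
  norm_num

/-- `3 m + 2 < 3^m` for `m ≥ 2`. [folklore] -/
theorem three_mul_add_two_lt_pow (m : ℕ) (hm : 2 ≤ m) : 3 * m + 2 < 3 ^ m := by
  induction m with
  | zero => omega
  | succ m ih =>
    rcases Nat.lt_or_ge m 2 with h | h
    · interval_cases m <;> simp_all
    · have := ih h
      rw [pow_succ]
      omega

/-- [Schoof2009, Exercise 4.1]: `ord₃ (k (k-1)) < [k/3]` for `k ≥ 5`; here in the form
`ord₃ C(k,2) < [k/3]`. [cite: Schoof2009, Exercise 4.1] -/
theorem padicValNat_choose_two_lt (k : ℕ) (hk : 5 ≤ k) : padicValNat 3 (k.choose 2) < k / 3 := by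
  rcases Nat.lt_or_ge k 6 with hk6 | hk6
  · have hk5 : k = 5 := by omega
    subst hk5
    have : padicValNat 3 (Nat.choose 5 2) = 0 := padicValNat.eq_zero_of_not_dvd (by decide)
    rw [this]
    norm_num
  · -- `3 ^ v ∣ C(k,2) ∣ k (k - 1)`, so `3 ^ v ≤ k < 3 ^ [k/3]`
    set v := padicValNat 3 (k.choose 2) with hv
    have hdvd : 3 ^ v ∣ k.choose 2 := pow_padicValNat_dvd
    have h2 : k.choose 2 * 2 = k * (k - 1) := by
      rw [Nat.choose_two_right, Nat.div_mul_cancel (Nat.even_mul_pred_self k).two_dvd]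
    have hk1 : 3 ^ v ∣ k * (k - 1) := by rw [← h2]; exact hdvd.mul_right 2
    have hk0 : k ≠ 0 := by omega
    have hk1' : k - 1 ≠ 0 := by omega
    have hvv : v = padicValNat 3 k + padicValNat 3 (k - 1) := by
      have h := congrArg (padicValNat 3) h2
      rwa [padicValNat.mul (Nat.choose_pos (by omega)).ne' two_ne_zero, padicValNat.mul hk0 hk1',
        padicValNat.eq_zero_of_not_dvd (by decide : ¬ 3 ∣ 2), add_zero] at h
    have hle : 3 ^ v ≤ k := by
      by_cases h3 : 3 ∣ k
      · have h3' : ¬ 3 ∣ k - 1 := by omega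
        rw [hvv, padicValNat.eq_zero_of_not_dvd h3', add_zero]
        exact Nat.le_of_dvd (by omega) pow_padicValNat_dvd
      · rw [hvv, padicValNat.eq_zero_of_not_dvd h3, zero_add]
        exact (Nat.le_of_dvd (by omega) pow_padicValNat_dvd).trans (Nat.sub_le k 1)
    have hlt : k < 3 ^ (k / 3) := by
      have h1 := three_mul_add_two_lt_pow (k / 3) (by omega)
      have h2 : k ≤ 3 * (k / 3) + 2 := by omega
      omega
    exact (Nat.pow_lt_pow_iff_right (by norm_num)).1 (lt_of_le_of_lt hle hlt)

/-- The 3-adic estimate of [Schoof2009, proof of Proposition 4.1]: for `5 ≤ k ≤ n` the term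
`C(n,k) c_k` has `ord₃ > ord₃ C(n,2)` (from `k(k-1) C(n,k) = n(n-1) C(n-2,k-2)`,
`ord₃ c_k ≥ [k/3] > ord₃ (k(k-1))`). [cite: Schoof2009, Proposition 4.1] -/
theorem padicValNat_choose_mul_c (n k : ℕ) (hk : 5 ≤ k) (hkn : k ≤ n) :
    padicValNat 3 (n.choose 2) + 1 ≤ padicValNat 3 (n.choose k * ((piE ^ k).c).natAbs) := by
  have hid : n.choose k * k.choose 2 = n.choose 2 * (n - 2).choose (k - 2) :=
    Nat.choose_mul (by omega)
  have hC : n.choose k ≠ 0 := (Nat.choose_pos hkn).ne'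
  have hCk : k.choose 2 ≠ 0 := (Nat.choose_pos (by omega)).ne'
  have hC2 : n.choose 2 ≠ 0 := (Nat.choose_pos (by omega)).ne'
  have hC' : (n - 2).choose (k - 2) ≠ 0 := (Nat.choose_pos (by omega)).ne'
  have hck0 : ((piE ^ k).c).natAbs ≠ 0 :=
    Int.natAbs_ne_zero.2 (piE_pow_pos k (by omega)).2.2.ne'
  have hv := congrArg (padicValNat 3) hid
  rw [padicValNat.mul hC hCk, padicValNat.mul hC2 hC'] at hv
  have h1 : k / 3 ≤ padicValNat 3 ((piE ^ k).c).natAbs := by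
    refine (padicValNat_dvd_iff_le hck0).1 ?_
    have := Int.natAbs_dvd_natAbs.2 (three_pow_dvd_piE_pow_c' k)
    simpa [Int.natAbs_pow] using this
  have h2 := padicValNat_choose_two_lt k hk
  rw [padicValNat.mul hC hck0]
  omega

/-- `c_0 = c_1 = 0`, `c_2 = 1`, `c_3 = 3`, `c_4 = 6` [Schoof2009, Table 4.1].
[cite: Schoof2009, Proposition 4.1] -/
theorem piE_pow_c_small : (piE ^ 0).c = 0 ∧ (piE ^ 1).c = 0 ∧ (piE ^ 2).c = 1 ∧ (piE ^ 3).c = 3 ∧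
    (piE ^ 4).c = 6 := by decide

/-- `3 ∤ m² - 5m + 8` (the values modulo `3` are `2, 1, 2`). [folklore] -/
theorem not_three_dvd_quadratic (m : ℤ) : ¬ (3 : ℤ) ∣ m ^ 2 - 5 * m + 8 := by
  intro h
  have h3 : ((m ^ 2 - 5 * m + 8 : ℤ) : ZMod 3) = 0 := (ZMod.intCast_zmod_eq_zero_iff_dvd _ 3).2 h
  push_cast at h3
  have key : ∀ z : ZMod 3, z ^ 2 - 5 * z + 8 ≠ 0 := by decide
  exact key _ h3

/-- The first three non-zero terms [Schoof2009, proof of Proposition 4.1, the displayed congruence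
`≡ n² + 1 (mod 3)`]: for `n ≥ 6`,
`2^(n-2) C(n,2) c_2 - 2^(n-3) C(n,3) c_3 + 2^(n-4) C(n,4) c_4 = 2^(n-4) C(n,2) M` with
`2M = (n-2)² - 5(n-2) + 8 ≡ n² + 1 ≢ 0 (mod 3)`, so its `ord₃` is exactly `ord₃ C(n,2)`.
[cite: Schoof2009, Proposition 4.1] -/
theorem first_terms (n : ℕ) (hn : 6 ≤ n) :
    ∃ M : ℤ, ¬ (3 : ℤ) ∣ M ∧
      (2 : ℤ) ^ (n - 2) * (n.choose 2 : ℤ) * 1 - 2 ^ (n - 3) * (n.choose 3 : ℤ) * 3 +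
        2 ^ (n - 4) * (n.choose 4 : ℤ) * 6 = 2 ^ (n - 4) * (n.choose 2 : ℤ) * M := by
  have h3 : n.choose 3 * 3 = n.choose 2 * (n - 2) := by
    have := Nat.choose_mul (n := n) (k := 3) (s := 2) (by norm_num)
    simpa using this
  have h4 : n.choose 4 * 6 = n.choose 2 * (n - 2).choose 2 := by
    have := Nat.choose_mul (n := n) (k := 4) (s := 2) (by norm_num)
    rw [show Nat.choose 4 2 = 6 by decide] at this
    simpa using this
  have hm2 : (n - 2).choose 2 * 2 = (n - 2) * (n - 2 - 1) := by
    rw [Nat.choose_two_right, Nat.div_mul_cancel (Nat.even_mul_pred_self _).two_dvd]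
  refine ⟨4 - 2 * ((n - 2 : ℕ) : ℤ) + ((n - 2).choose 2 : ℤ), ?_, ?_⟩
  · intro hd
    apply not_three_dvd_quadratic ((n - 2 : ℕ) : ℤ)
    have e : ((n - 2 : ℕ) : ℤ) ^ 2 - 5 * ((n - 2 : ℕ) : ℤ) + 8 =
        2 * (4 - 2 * ((n - 2 : ℕ) : ℤ) + ((n - 2).choose 2 : ℤ)) := by
      have hm2' : (((n - 2).choose 2 : ℕ) : ℤ) * 2 = ((n - 2 : ℕ) : ℤ) * ((n - 2 - 1 : ℕ) : ℤ) := by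
        exact_mod_cast hm2
      have hsub : ((n - 2 - 1 : ℕ) : ℤ) = ((n - 2 : ℕ) : ℤ) - 1 := by
        rw [Nat.cast_sub (by omega)]; simp
      rw [hsub] at hm2'
      nlinarith [hm2']
    rw [e]
    exact hd.mul_left 2
  · have h3' : ((n.choose 3 : ℕ) : ℤ) * 3 = (n.choose 2 : ℤ) * ((n - 2 : ℕ) : ℤ) := by
      exact_mod_cast h3
    have h4' : ((n.choose 4 : ℕ) : ℤ) * 6 = (n.choose 2 : ℤ) * ((n - 2).choose 2 : ℤ) := by
      exact_mod_cast h4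
    have e2 : (2 : ℤ) ^ (n - 2) = 2 ^ (n - 4) * 4 := by
      rw [show n - 2 = (n - 4) + 2 by omega, pow_add]; norm_num
    have e3 : (2 : ℤ) ^ (n - 3) = 2 ^ (n - 4) * 2 := by
      rw [show n - 3 = (n - 4) + 1 by omega, pow_add]; norm_num
    rw [e2, e3]
    linear_combination (2 : ℤ) ^ (n - 4) * (-(2 : ℤ)) * h3' + (2 : ℤ) ^ (n - 4) * h4'

/-- **[Schoof2009, Proposition 4.1]** (W. McCallum, via Skolem's `3`-adic method): the
`∛4`-coefficient of `ηⁿ`, `η = ∛2 - 1`, vanishes only for `n = 0` and `n = 1` (`n : ℕ`); for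
negative exponents see `etaInv_pow_pos`. [cite: Schoof2009, Proposition 4.1] -/
theorem eta_pow_c_eq_zero {n : ℕ} (h : (eta ^ n).c = 0) : n = 0 ∨ n = 1 := by
  by_contra hn
  push Not at hn
  have hn2 : 2 ≤ n := by omega
  rcases Nat.lt_or_ge n 6 with hn6 | hn6
  · -- small exponents by computation
    interval_cases n <;> revert h <;> decide
  · -- `n ≥ 6`: the 3-adic argument
    have hS : ((-eta) ^ n).c = 0 := by
      have := eta_pow_c n
      rw [h] at this
      rcases neg_one_pow_eq_or ℤ n with h1 | h1 <;> rw [h1] at this <;> linarith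
    rw [neg_eta_pow_c, ← Finset.sum_range_add_sum_Ico _ (show 5 ≤ n + 1 by omega)] at hS
    -- the first five terms
    obtain ⟨c0, c1, c2, c3, c4⟩ := piE_pow_c_small
    simp only [Finset.sum_range_succ, Finset.sum_range_zero, c0, c1, c2, c3, c4, zero_add] at hS
    obtain ⟨M, hM3, hM⟩ := first_terms n hn6
    set v := padicValNat 3 (n.choose 2) with hv
    -- the tail is divisible by `3 ^ (v + 1)`
    have htail : (3 : ℤ) ^ (v + 1) ∣
        ∑ k ∈ Finset.Ico 5 (n + 1), (-1) ^ k * (piE ^ k).c * 2 ^ (n - k) * (n.choose k : ℤ) := by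
      refine Finset.dvd_sum fun k hk => ?_
      rw [Finset.mem_Ico] at hk
      have hb := padicValNat_choose_mul_c n k hk.1 (by omega)
      have hne : n.choose k * ((piE ^ k).c).natAbs ≠ 0 :=
        mul_ne_zero (Nat.choose_pos (by omega)).ne'
          (Int.natAbs_ne_zero.2 (piE_pow_pos k (by omega)).2.2.ne')
      have hd : 3 ^ (v + 1) ∣ n.choose k * ((piE ^ k).c).natAbs := (padicValNat_dvd_iff_le hne).2 hb
      have hdZ : (3 : ℤ) ^ (v + 1) ∣ (n.choose k : ℤ) * (piE ^ k).c := by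
        have h1 : ((3 ^ (v + 1) : ℕ) : ℤ) ∣ ((n.choose k * ((piE ^ k).c).natAbs : ℕ) : ℤ) :=
          Int.natCast_dvd_natCast.2 hd
        push_cast at h1
        rw [← Nat.abs_cast (n.choose k), ← abs_mul, dvd_abs] at h1
        exact h1
      have e : (-1) ^ k * (piE ^ k).c * 2 ^ (n - k) * (n.choose k : ℤ) =
          (n.choose k : ℤ) * (piE ^ k).c * ((-1) ^ k * 2 ^ (n - k)) := by ring
      rw [e]
      exact hdZ.mul_right _
    -- hence `3 ^ (v + 1)` divides the first terms `2 ^ (n - 4) C(n,2) M`, i.e. `C(n,2)`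
    have hFT : (3 : ℤ) ^ (v + 1) ∣ 2 ^ (n - 4) * (n.choose 2 : ℤ) * M := by
      rw [← hM]
      have e : (2 : ℤ) ^ (n - 2) * (n.choose 2 : ℤ) * 1 - 2 ^ (n - 3) * (n.choose 3 : ℤ) * 3 +
          2 ^ (n - 4) * (n.choose 4 : ℤ) * 6 =
          -∑ k ∈ Finset.Ico 5 (n + 1), (-1) ^ k * (piE ^ k).c * 2 ^ (n - k) * (n.choose k : ℤ) := by
        linear_combination hS
      rw [e, dvd_neg]
      exact htail
    have h3M : ¬ (3 : ℤ) ∣ 2 ^ (n - 4) * M := by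
      intro hd
      rcases Int.prime_three.dvd_or_dvd hd with h2 | h2
      · have := Int.prime_three.dvd_of_dvd_pow h2
        norm_num at this
      · exact hM3 h2
    have hcop : IsCoprime ((3 : ℤ) ^ (v + 1)) (2 ^ (n - 4) * M) :=
      ((Prime.coprime_iff_not_dvd Int.prime_three).2 h3M).pow_left
    have hC2 : (3 : ℤ) ^ (v + 1) ∣ (n.choose 2 : ℤ) := by
      refine hcop.dvd_of_dvd_mul_right ?_
      have e : (n.choose 2 : ℤ) * (2 ^ (n - 4) * M) = 2 ^ (n - 4) * (n.choose 2 : ℤ) * M := by ring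
      rw [e]
      exact hFT
    have hC2' : 3 ^ (v + 1) ∣ n.choose 2 := by exact_mod_cast hC2
    exact pow_succ_padicValNat_not_dvd (Nat.choose_pos (by omega)).ne' hC2'

/-! ## [Schoof2009, Proposition 4.2]: Euler's theorem on `x² - y³ = 1` -/

/-- **The Thue equation `v³ - 2u³ = 1`** [Schoof2009, proof of Proposition 4.2]: its only
integer solutions are `(u, v) = (0, 1)` and `(-1, -1)`. Indeed `ε = v - uθ` has norm `1`, so
`ε = ± ηⁿ` or `± (η⁻¹)ⁿ` (`exists_eq_eta_pow_of_norm`); the sign is `+` by norms, `(η⁻¹)ⁿ` has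
positive `θ²`-coefficient for `n ≥ 1`, and `ηⁿ` has vanishing `θ²`-coefficient only for
`n = 0, 1` (Proposition 4.1). [cite: Schoof2009, Proposition 4.2] -/
theorem thue_cubic {u v : ℤ} (h : v ^ 3 - 2 * u ^ 3 = 1) :
    (u = 0 ∧ v = 1) ∨ (u = -1 ∧ v = -1) := by
  set ε : ZCbrt := ⟨v, -u, 0⟩ with hε
  have hN : norm ε = 1 := by
    simp only [norm, hε]
    linear_combination h
  obtain ⟨n, hn | hn | hn | hn⟩ := exists_eq_eta_pow_of_norm (Or.inl hN)
  · have hc : (eta ^ n).c = 0 := by rw [← hn]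
    rcases eta_pow_c_eq_zero hc with rfl | rfl
    · rw [pow_zero, ZCbrt.ext_iff] at hn
      simp only [one_a, one_b, one_c] at hn
      left
      exact ⟨by linarith [hn.2.1], hn.1⟩
    · rw [pow_one, ZCbrt.ext_iff] at hn
      simp only [eta] at hn
      right
      exact ⟨by linarith [hn.2.1], hn.1⟩
  · rcases Nat.eq_zero_or_pos n with rfl | hn1
    · rw [pow_zero, ZCbrt.ext_iff] at hn
      simp only [one_a, one_b, one_c] at hn
      left
      exact ⟨by linarith [hn.2.1], hn.1⟩
    · exfalso
      have hpos := (etaInv_pow_pos n hn1).2.2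
      rw [← hn] at hpos
      simp [hε] at hpos
  · exfalso
    have h1 := congrArg norm hn
    rw [hN, norm_neg, norm_pow, norm_eta, one_pow] at h1
    norm_num at h1
  · exfalso
    have h1 := congrArg norm hn
    rw [hN, norm_neg, norm_pow, norm_etaInv, one_pow] at h1
    norm_num at h1

end ZCbrt

namespace Catalan

/-- [Schoof2009, proof of Proposition 4.2], the case `x ≡ 1 (mod 4)`: then
`(x - 1)/4 · (x + 1)/2 = (y/2)³` with coprime factors, so `(x - 1)/4 = u³`, `(x + 1)/2 = v³`,
`v³ - 2u³ = 1`, and the Thue equation leaves only `x = -3`, `y = 2` (the solution `u = 0` gives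
`y = 0`). [cite: Schoof2009, Proposition 4.2] -/
theorem euler_of_mod_four {x y : ℤ} (hy : y ≠ 0) (h : x ^ 2 - y ^ 3 = 1) (hx4 : x % 4 = 1) :
    x = -3 ∧ y = 2 := by
  obtain ⟨k, rfl⟩ : ∃ k, x = 4 * k + 1 := ⟨x / 4, by omega⟩
  have hy3 : y ^ 3 = 8 * (k * (2 * k + 1)) := by linear_combination -h
  have he : Even (y ^ 3) := by
    rw [hy3]
    exact ⟨4 * (k * (2 * k + 1)), by ring⟩
  obtain ⟨w, rfl⟩ : Even y := (Int.even_pow.1 he).1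
  have hw : k * (2 * k + 1) = w ^ 3 := by
    have h8 : (8 : ℤ) * (k * (2 * k + 1)) = 8 * w ^ 3 := by rw [← hy3]; ring
    exact mul_left_cancel₀ (by norm_num) h8
  have hcop : IsCoprime k (2 * k + 1) := ⟨-2, 1, by ring⟩
  obtain ⟨⟨u, hu⟩, ⟨v, hv⟩⟩ := Int.eq_pow_of_mul_eq_pow_odd hcop (by decide : Odd 3) hw
  have ht : v ^ 3 - 2 * u ^ 3 = 1 := by rw [← hu, ← hv]; ring
  rcases ZCbrt.thue_cubic ht with ⟨rfl, rfl⟩ | ⟨rfl, rfl⟩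
  · exfalso
    norm_num at hu
    subst hu
    have hw0 : w ^ 3 = 0 := by rw [← hw]; ring
    have : w = 0 := pow_eq_zero_iff (by norm_num) |>.1 hw0
    subst this
    exact hy (by norm_num)
  · norm_num at hu
    subst hu
    have hw1 : w ^ 3 = 1 := by rw [← hw]; norm_num
    have hw1' : w = 1 := by
      have hmono : StrictMono fun t : ℤ => t ^ 3 := Odd.strictMono_pow (by decide)
      exact hmono.injective (show w ^ 3 = 1 ^ 3 by rw [hw1, one_pow])
    subst hw1'
    norm_num

/-- **Euler (1738)** [Schoof2009, Proposition 4.2] (proof of W. McCallum via Skolem's method):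
the only solutions of `x ^ 2 - y ^ 3 = 1` in non-zero integers are `(x, y) = (±3, 2)`; in
particular the only non-trivial solutions of Catalan's equation with exponents `p = 2`, `q = 3`.
If `x` is even, `x ± 1` are coprime cubes differing by `2`, forcing `x = 0`; if `x` is odd one
normalises `x ≡ 1 (mod 4)` by a sign and applies `euler_of_mod_four`.
[cite: Schoof2009, Proposition 4.2] -/
theorem euler {x y : ℤ} (hx : x ≠ 0) (hy : y ≠ 0) (h : x ^ 2 - y ^ 3 = 1) :
    (x = 3 ∨ x = -3) ∧ y = 2 := by
  have hxodd : Odd x := by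
    by_contra hxo
    obtain ⟨m, rfl⟩ : Even x := Int.not_odd_iff_even.1 hxo
    have hcop : IsCoprime (m + m - 1) (m + m + 1) := ⟨m, 1 - m, by ring⟩
    have hprod : (m + m - 1) * (m + m + 1) = y ^ 3 := by linear_combination h
    obtain ⟨⟨s, hs⟩, ⟨t, ht⟩⟩ := Int.eq_pow_of_mul_eq_pow_odd hcop (by decide : Odd 3) hprod
    have hts : t ^ 3 - s ^ 3 = 2 := by rw [← hs, ← ht]; ring
    obtain ⟨rfl, -⟩ := eq_of_pow_sub_pow_eq_two (by decide : Odd 3) le_rfl hts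
    norm_num at hs
    exact hx (by linarith)
  have hx2 : x % 4 = 1 ∨ x % 4 = 3 := by obtain ⟨r, rfl⟩ := hxodd; omega
  rcases hx2 with h4 | h4
  · obtain ⟨hx3, hy2⟩ := euler_of_mod_four hy h h4
    exact ⟨Or.inr hx3, hy2⟩
  · obtain ⟨hx3, hy2⟩ := euler_of_mod_four (x := -x) hy (by rw [neg_sq]; exact h) (by omega)
    exact ⟨Or.inl (by linarith), hy2⟩

end Catalan

end Literature.NumberTheory.DiophantineGeometry
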